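import Summits.AtomisticToContinuum.Crystallization.Theses.ThreeConeCertificate
import Literature.MathematicalPhysics.StatisticalMechanics.LennardJonesClusters
import Literature.MathematicalPhysics.StatisticalMechanics.CrystallizationSymmetries
import Literature.MathematicalPhysics.StatisticalMechanics.BarlowStacking
import Literature.MathematicalPhysics.StatisticalMechanics.HaggStacking
import Literature.MathematicalPhysics.StatisticalMechanics.HcpHomogeneous

/-!
# Disproof of `SlackRigidity` (crux `stmt-AtomisticToContinuum-11960`, route ThreeConeCertificate) — findings

Standing adversary file (cdisprove seat `refuter-cdisprove-stmt-AtomisticToContinuum-11960-0`).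
Prose lives in docstrings; every `theorem` below is sorry-free unless it sits in § Near-misses.

`SlackRigidity` (verbatim `slackRigidity_iff`): `∃ P` periodic, `∀ R ε > 0`, along EVERY sequence
of injective configurations `x N : Fin N → ℝ³` with energy excess `(𝓔(x N) − E(N))/N → 0`, the
fraction of particles whose `R`-environment is not `ε`-matched (both ways) to `x i + A (P.points)`
for some linear isometry `A` tends to `0`.

## Verdict so far: NO KILL (cycle 1).  Why it resists

The statement is the quantitative form of "relaxed hcp is the unique (up to `O(3)`), coercively
stable minimiser of the Lennard-Jones energy per particle in `ℝ³`".  Every cheap attack lands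
inside the `o(N)` allowance for FIXED `(R, ε)`:
* isolated particles / escaping sub-clusters: `K` of them cost `≥ K·|e*| + o` ⇒ `K = o(N)`;
* `m` stacking-fault / twin / grain-boundary planes cost `≍ m N^{2/3} γ` ⇒ `m = o(N^{1/3})`, and
  they spoil only `≍ m R N^{2/3} = o(N)` environments (needs `γ > 0`, see NUMERICS);
* slowly varying strain / rotation fields of total cost `o(N)` have local strain `→ 0`, hence are
  absorbed by `ε` and by the particle-dependent `A`;
* thin slabs / needles / foams: surface `o(N)` is forced by the excess hypothesis itself;
* finite-`N` icosahedral / decahedral minimisers are irrelevant (`N → ∞` at fixed `R, ε`).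
A substantive kill needs one of: an exact energy tie between non-isometric periodic minimisers,
an aperiodic optimal stacking, a non-vertex-transitive optimal polytype
(`rigidFor_vertexTransitive` below makes this a GENUINE extra content of the typed statement),
or a zero-cost soft mode — none is formalisable into `¬ S` today; the numerics (§ Numerics)
point the other way (job `j008617`: hcp wins every stacking by `M = 7.24·10⁻⁵` per c-layer; strict
local minimality of relaxed hcp, Hessian eigenvalues `≥ 2.24`).

## Contents (Lean)

* § Setup — `Good`, `badCount`, `RigidFor`, `slackRigidity_iff` (definitional repackaging);
  the ground-state sequence `gs` (tree: `LennardJonesGroundStatesExist_holds`) satisfies the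
  hypotheses with excess `≡ 0` (`excessVanishes_gs`) — NOT VACUOUS.
* § Load-bearing hypotheses — `not_rigidForWithoutEnergy`: drop the excess hypothesis and the
  conclusion fails for EVERY `P` (collinear far-spaced configurations); any proof must use it.
  `not_rigidForWithoutRotations`: freeze `A = 1` (translations only) and it fails for every
  `P` (ground states can be reflected; a witness would contain whole spheres) — the isometry is
  load-bearing.
* § Necessary conditions on a witness `P` (what the typed matching silently demands):
  `zero_mem_points_of_rigidFor` (`0 ∈ P.points`), `norm_le_of_mem_points_of_rigidFor` (no point of
  `P` in the punctured `δ`-ball, `δ` = uniform ground-state separation, tree `δ = 1/3`),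
  `rigidFor_unique_up_to_isometry` (two witnesses are `O(3)`-congruent at every `(R, ε)`),
  `rigidFor_vertexTransitive` (a witness looks the same, up to a linear isometry, from EVERY one
  of its points, at every `(R, ε)`): hcp and fcc pass, dhcp/4H, 6H, 9R and all longer polytypes
  FAIL (inequivalent h/c sites) — so `S` asserts more than "crystallisation onto one periodic `P`".
  `rigidFor_uniformlyDiscrete` (distinct points of a witness are `≥ δ` apart).
* § Refuted strengthenings — `not_forall_rigidFor` (the `∀ P` version is false: over-dense hcp).
* § Sanity — `hcp_passes_vertexTransitivity` (via the landed `hcpStacking_homogeneous`): hcp IS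
  vertex-transitive under linear isometries (identity / half-turn), so the intended witness passes.
* § Numerics — kit job `j008617` (done): hcp beats every close-packed stacking by `M = 7.24·10⁻⁵` per
  c-layer, relaxation gains `≤ 6·10⁻⁸`, hcp 9×9 Hessian eigenvalues `≥ 2.24 > 0` (docstring `numerics_note`).
* § Near-misses / targets — none open (no stubs registered yet: `targets = []`).

## Landed (importable) copies of the conclusive lemmas

* `Summits/AtomisticToContinuum/Crystallization/Theorems/SlackRigidity/Negative/WitnessBasics.lean`
  (p73252, commit 2d28b59002ff): § Setup, `not_rigidForWithoutEnergy`, `zero_mem_points_of_rigidFor`,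
  `norm_le_of_mem_points_of_rigidFor`, `not_forall_rigidFor`
  (namespace `Summit.AtomisticToContinuum.Crystallization.Theorems.SlackRigidityNegative`).
* `…/Negative/WitnessTransitive.lean` (p73717, a7f6df16746f): `FewBad` lemmas,
  `rigidFor_unique_up_to_isometry`, `rigidFor_vertexTransitive`, `rigidFor_uniformlyDiscrete`.
* `…/Negative/WithoutRotations.lean` (p73831, 1c14eb7618fb): `not_rigidForWithoutRotations`.
* `Literature/MathematicalPhysics/StatisticalMechanics/HcpHomogeneous.lean` (p73417, b1b50a35c3b0):
  `halfTurn`, `hcpStacking_homogeneous` (imported here; `hcp_passes_vertexTransitivity`).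
-/

noncomputable section

open scoped BigOperators Topology
open Filter Set Metric

namespace Summit.AtomisticToContinuum.Crystallization.Cruxes.SlackRigidity.Disproof

open Literature.MathematicalPhysics.StatisticalMechanics
open Summit.AtomisticToContinuum.Crystallization.Theses.ThreeConeCertificate (SlackRigidity)

/-! ## § Setup -/

/-- Ambient space `ℝ³`. -/
abbrev E3 := EuclideanSpace ℝ (Fin 3)

/-- Particle `i` of the configuration `x` is `(R, ε)`-matched to `P`: verbatim the predicate
negated inside `SlackRigidity` (two-way `ε`-matching of `B_R(x i)` with `x i + A(P.points ∩ B_R)`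
for some linear isometry `A`). -/
def Good (P : PeriodicConfiguration 3) (R ε : ℝ) {N : ℕ} (x : Fin N → E3) (i : Fin N) : Prop :=
  ∃ A : E3 →ₗᵢ[ℝ] E3, (∀ p ∈ P.points, ‖p‖ ≤ R → ∃ j : Fin N, dist (x j) (x i + A p) ≤ ε) ∧
    (∀ j : Fin N, dist (x j) (x i) ≤ R → ∃ p ∈ P.points, dist (x j) (x i + A p) ≤ ε)

/-- Number of unmatched ("bad") particles. -/
def badCount (P : PeriodicConfiguration 3) (R ε : ℝ) {N : ℕ} (x : Fin N → E3) : ℕ :=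
  Nat.card {i : Fin N // ¬ Good P R ε x i}

/-- The conclusion of the crux for `P` along the sequence `x`: bad fraction `→ 0`. -/
def BadFractionVanishes (P : PeriodicConfiguration 3) (R ε : ℝ) (x : (N : ℕ) → Fin N → E3) : Prop :=
  Tendsto (fun N : ℕ => (badCount P R ε (x N) : ℝ) / N) atTop (𝓝 0)

/-- The energy hypothesis of the crux: excess `o(N)`. -/
def ExcessVanishes (x : (N : ℕ) → Fin N → E3) : Prop :=
  Tendsto (fun N : ℕ => (interactionEnergy lennardJones (x N) -
    groundStateEnergy lennardJones 3 N) / N) atTop (𝓝 0)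

/-- The crux with its witness exposed: `SlackRigidity ↔ ∃ P, RigidFor P`. -/
def RigidFor (P : PeriodicConfiguration 3) : Prop :=
  ∀ R ε : ℝ, 0 < R → 0 < ε → ∀ x : (N : ℕ) → Fin N → E3, (∀ N, Function.Injective (x N)) →
    ExcessVanishes x → BadFractionVanishes P R ε x

/-- Readback: the route declaration is literally `∃ P, RigidFor P`. -/
theorem slackRigidity_iff : SlackRigidity ↔ ∃ P, RigidFor P := Iff.rfl

/-- A sequence of Lennard-Jones ground states, one for each `N` (tree theorem
`LennardJonesGroundStatesExist_holds`, Blanc–Lewin 2015 §1.2). -/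
def gs (N : ℕ) : Fin N → E3 := Classical.choose (LennardJonesGroundStatesExist_holds N)

theorem gs_isGroundState (N : ℕ) : IsGroundState lennardJones (gs N) :=
  Classical.choose_spec (LennardJonesGroundStatesExist_holds N)

theorem gs_injective (N : ℕ) : Function.Injective (gs N) := (gs_isGroundState N).1

/-- NON-VACUITY: ground states have excess `≡ 0`, so the hypotheses of the crux are met by `gs`
(and by `φ ∘ gs` for any isometries `φ_N`). -/
theorem excessVanishes_of_isGroundState {x : (N : ℕ) → Fin N → E3}
    (hx : ∀ N, IsGroundState lennardJones (x N)) : ExcessVanishes x := by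
  have : (fun N : ℕ => (interactionEnergy lennardJones (x N) -
      groundStateEnergy lennardJones 3 N) / N) = fun _ => 0 := by
    funext N; rw [(hx N).2, sub_self, zero_div]
  simp only [ExcessVanishes, this]
  exact tendsto_const_nhds

theorem excessVanishes_gs : ExcessVanishes gs := excessVanishes_of_isGroundState gs_isGroundState

/-- Uniform separation of the ground-state sequence (tree theorem
`LennardJonesMinimalDistance_holds`, `δ = 1/3`). -/
theorem gs_separated : ∃ δ : ℝ, 0 < δ ∧ ∀ N (i j : Fin N), i ≠ j → δ ≤ dist (gs N i) (gs N j) := by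
  obtain ⟨δ, hδ, h⟩ := LennardJonesMinimalDistance_holds
  exact ⟨δ, hδ, fun N i j hij => h N (gs N) (gs_isGroundState N) i j hij⟩

/-- If every particle is bad the bad count is `N`. -/
theorem badCount_eq_of_forall_bad {P : PeriodicConfiguration 3} {R ε : ℝ} {N : ℕ} {x : Fin N → E3}
    (h : ∀ i, ¬ Good P R ε x i) : badCount P R ε x = N := by
  unfold badCount
  rw [Nat.card_congr (Equiv.subtypeUnivEquiv h), Nat.card_eq_fintype_card, Fintype.card_fin]

/-- If along a sequence every particle is bad, the bad fraction is eventually `1`, not `→ 0`. -/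
theorem not_badFractionVanishes_of_forall_bad {P : PeriodicConfiguration 3} {R ε : ℝ}
    {x : (N : ℕ) → Fin N → E3} (h : ∀ N (i : Fin N), ¬ Good P R ε (x N) i) :
    ¬ BadFractionVanishes P R ε x := by
  intro hT
  have h1 : Tendsto (fun N : ℕ => (badCount P R ε (x N) : ℝ) / N) atTop (𝓝 1) := by
    refine (tendsto_const_nhds (x := (1 : ℝ))).congr' ?_
    filter_upwards [eventually_ge_atTop 1] with N hN
    rw [badCount_eq_of_forall_bad (h N)]
    have : (N : ℝ) ≠ 0 := by exact_mod_cast Nat.one_le_iff_ne_zero.1 hN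
    rw [div_self this]
  exact zero_ne_one (tendsto_nhds_unique hT h1)

/-- The distance from `x i` to the image point `x i + A p` is `‖p‖`. -/
theorem dist_add_linearIsometry (A : E3 →ₗᵢ[ℝ] E3) (z p : E3) : dist (z + A p) z = ‖p‖ := by
  rw [dist_eq_norm, add_sub_cancel_left, A.norm_map]

/-! ## § Load-bearing hypotheses -/

/-- The crux's inner statement for a witness `P` with the ENERGY-EXCESS HYPOTHESIS DROPPED (all
injective sequences). -/
def RigidForWithoutEnergy (P : PeriodicConfiguration 3) : Prop :=
  ∀ R ε : ℝ, 0 < R → 0 < ε → ∀ x : (N : ℕ) → Fin N → E3,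
    (∀ N, Function.Injective (x N)) → BadFractionVanishes P R ε x

/-- A periodic configuration containing `0` contains a non-zero point (its lattice has full rank). -/
theorem exists_ne_zero_mem_points (P : PeriodicConfiguration 3) (h0 : (0 : E3) ∈ P.points) :
    ∃ p ∈ P.points, p ≠ 0 := by
  -- the lattice is not `⊥` since it spans `ℝ³`
  have hspan : Submodule.span ℝ (P.lattice : Set E3) = ⊤ := IsZLattice.span_top
  by_contra hnone
  have hL : ∀ g ∈ P.lattice, g = 0 := by
    intro g hg
    have : (0 : E3) + g ∈ P.points := P.add_mem_points h0 hg
    rw [zero_add] at this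
    by_contra hg0
    exact hnone ⟨g, this, hg0⟩
  have hbot : (P.lattice : Set E3) ⊆ {0} := fun g hg => hL g hg
  have : Submodule.span ℝ (P.lattice : Set E3) ≤ Submodule.span ℝ ({0} : Set E3) :=
    Submodule.span_mono hbot
  rw [hspan, Submodule.span_zero_singleton, top_le_iff] at this
  -- `⊥ = ⊤` in `ℝ³` is absurd: the vector `single 0 1` is non-zero
  have hv : (EuclideanSpace.single (0 : Fin 3) (1 : ℝ) : E3) ∈ (⊥ : Submodule ℝ E3) := by
    rw [this]; exact Submodule.mem_top
  rw [Submodule.mem_bot] at hv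
  have := congrArg (fun v : E3 => v 0) hv
  simp at this

/-- **`_false_without_` (energy).** Without the excess hypothesis the conclusion fails for EVERY
periodic `P`: if `0 ∉ P.points` every particle of every configuration is bad at small `ε`
(clause (b) with `j = i`); if `0 ∈ P.points`, take a non-zero `p ∈ P.points` and the collinear
configurations `i ↦ (4 i) • p`: all mutual distances are multiples of `4‖p‖`, so no particle sits
at distance `∈ [¾‖p‖, 1¼‖p‖]` from another and clause (a) fails for `p`. (Such sequences have
excess `≥ (N−1)/12 · O(1)`, rightly excluded by `S`.) Any proof of the crux must use the energy. -/
theorem not_rigidForWithoutEnergy (P : PeriodicConfiguration 3) : ¬ RigidForWithoutEnergy P := by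
  intro hP
  by_cases h0 : (0 : E3) ∈ P.points
  · obtain ⟨p, hp, hp0⟩ := exists_ne_zero_mem_points P h0
    have hpn : 0 < ‖p‖ := norm_pos_iff.2 hp0
    set x : (N : ℕ) → Fin N → E3 := fun N i => (4 * ((i : ℕ) : ℝ)) • p with hx
    have hinj : ∀ N, Function.Injective (x N) := by
      intro N i j hij
      have h1 : (4 * ((i : ℕ) : ℝ)) • p = (4 * ((j : ℕ) : ℝ)) • p := hij
      have h2 : (4 * ((i : ℕ) : ℝ)) = 4 * ((j : ℕ) : ℝ) := smul_left_injective ℝ hp0 h1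
      have h3 : ((i : ℕ) : ℝ) = ((j : ℕ) : ℝ) := by linarith
      exact Fin.ext (by exact_mod_cast h3)
    have hdist : ∀ N (i j : Fin N), dist (x N j) (x N i) = |((j : ℕ) : ℝ) - ((i : ℕ) : ℝ)| * (4 * ‖p‖) := by
      intro N i j
      simp only [hx, dist_eq_norm, ← sub_smul, norm_smul, Real.norm_eq_abs]
      rw [show (4 : ℝ) * ((j : ℕ) : ℝ) - 4 * ((i : ℕ) : ℝ) = 4 * (((j : ℕ) : ℝ) - ((i : ℕ) : ℝ)) by ring,
        abs_mul, abs_of_pos (by norm_num : (0 : ℝ) < 4)]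
      ring
    have hbad : ∀ N (i : Fin N), ¬ Good P ‖p‖ (‖p‖ / 4) (x N) i := by
      rintro N i ⟨A, h1, -⟩
      obtain ⟨j, hj⟩ := h1 p hp le_rfl
      have htri : |dist (x N j) (x N i) - ‖p‖| ≤ ‖p‖ / 4 := by
        have h := abs_dist_sub_le (x N j) (x N i + A p) (x N i)
        rw [dist_add_linearIsometry] at h
        -- |d(j,i) - ‖p‖| ≤ d(j, i + Ap)
        have h' : |dist (x N j) (x N i) - ‖p‖| ≤ dist (x N j) (x N i + A p) := by
          have := abs_sub_comm (dist (x N j) (x N i)) ‖p‖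
          calc |dist (x N j) (x N i) - ‖p‖|
              = |dist (x N j) (x N i) - dist (x N i + A p) (x N i)| := by rw [dist_add_linearIsometry]
            _ ≤ dist (x N j) (x N i + A p) := abs_dist_sub_le _ _ _
        exact h'.trans hj
      rw [hdist] at htri
      set k : ℝ := |((j : ℕ) : ℝ) - ((i : ℕ) : ℝ)| with hk
      -- `k` is a natural number (as a real): either `0` or `≥ 1`
      have hk_cases : k = 0 ∨ 1 ≤ k := by
        have : ∃ n : ℕ, k = n := by
          rcases le_total ((i : ℕ)) ((j : ℕ)) with hle | hle
          · refine ⟨(j : ℕ) - (i : ℕ), ?_⟩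
            rw [hk, Nat.cast_sub hle, abs_of_nonneg (by rw [sub_nonneg]; exact_mod_cast hle)]
          · refine ⟨(i : ℕ) - (j : ℕ), ?_⟩
            rw [hk, Nat.cast_sub hle, abs_sub_comm,
              abs_of_nonneg (by rw [sub_nonneg]; exact_mod_cast hle)]
        obtain ⟨n, hn⟩ := this
        rcases Nat.eq_zero_or_pos n with h | h
        · left; rw [hn, h, Nat.cast_zero]
        · right; rw [hn]; exact_mod_cast h
      rcases hk_cases with hk0 | hk1
      · rw [hk0, zero_mul, zero_sub, abs_neg, abs_of_pos hpn] at htri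
        linarith
      · have : 4 * ‖p‖ ≤ k * (4 * ‖p‖) := le_mul_of_one_le_left (by positivity) hk1
        have h5 : k * (4 * ‖p‖) - ‖p‖ ≤ ‖p‖ / 4 := (le_abs_self _).trans htri
        linarith
    exact not_badFractionVanishes_of_forall_bad hbad
      (hP ‖p‖ (‖p‖ / 4) hpn (by positivity) x hinj)
  · -- `0 ∉ P.points`: a small ball about `0` misses `P.points`; clause (b) with `j = i` fails
    have hfin : (closedBall (0 : E3) 1 ∩ P.points).Finite := P.finite_inter_points isBounded_closedBall
    have hopen : IsOpen (closedBall (0 : E3) 1 ∩ P.points)ᶜ := hfin.isClosed.isOpen_compl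
    have hmem : (0 : E3) ∈ (closedBall (0 : E3) 1 ∩ P.points)ᶜ := fun h => h0 h.2
    obtain ⟨ε₀, hε₀, hball⟩ := Metric.mem_nhds_iff.1 (hopen.mem_nhds hmem)
    obtain ⟨ε, hε, hε1, hε2⟩ : ∃ ε : ℝ, 0 < ε ∧ ε ≤ ε₀ / 2 ∧ ε ≤ 1 / 2 :=
      ⟨min (ε₀ / 2) (1 / 2), lt_min (by linarith) (by norm_num), min_le_left _ _, min_le_right _ _⟩
    have hfar : ∀ q ∈ P.points, ε < ‖q‖ := by
      intro q hq
      by_contra hle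
      rw [not_lt] at hle
      have hq1 : q ∈ closedBall (0 : E3) 1 := by
        rw [mem_closedBall, dist_zero_right]; linarith
      have hq2 : q ∈ ball (0 : E3) ε₀ := by
        rw [mem_ball, dist_zero_right]; linarith
      exact hball hq2 ⟨hq1, hq⟩
    have hbad : ∀ N (i : Fin N), ¬ Good P 1 ε (gs N) i := by
      rintro N i ⟨A, -, h2⟩
      obtain ⟨q, hq, hqi⟩ := h2 i (by simp)
      rw [dist_comm, dist_add_linearIsometry] at hqi
      have := hfar q hq
      linarith
    exact not_badFractionVanishes_of_forall_bad hbad (hP 1 ε one_pos hε gs gs_injective)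

/-- Hence no periodic configuration at all satisfies the energy-free version. -/
theorem not_exists_rigidForWithoutEnergy :
    ¬ ∃ P : PeriodicConfiguration 3, RigidForWithoutEnergy P :=
  fun ⟨P, hP⟩ => not_rigidForWithoutEnergy P hP

/-! ## § Necessary conditions on a witness -/

/-- **A witness contains the origin** (clause (b) with `j = i` at every `ε`; uses only that the
hypotheses are satisfiable, `excessVanishes_gs`). Hence "P = hcp" must be read with a particle AT
`0` (the route's informal text says so; the typed statement enforces it). -/
theorem zero_mem_points_of_rigidFor {P : PeriodicConfiguration 3} (hP : RigidFor P) :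
    (0 : E3) ∈ P.points := by
  by_contra h0
  have hfin : (closedBall (0 : E3) 1 ∩ P.points).Finite := P.finite_inter_points isBounded_closedBall
  have hopen : IsOpen (closedBall (0 : E3) 1 ∩ P.points)ᶜ := hfin.isClosed.isOpen_compl
  have hmem : (0 : E3) ∈ (closedBall (0 : E3) 1 ∩ P.points)ᶜ := fun h => h0 h.2
  obtain ⟨ε₀, hε₀, hball⟩ := Metric.mem_nhds_iff.1 (hopen.mem_nhds hmem)
  obtain ⟨ε, hε, hε1, hε2⟩ : ∃ ε : ℝ, 0 < ε ∧ ε ≤ ε₀ / 2 ∧ ε ≤ 1 / 2 :=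
    ⟨min (ε₀ / 2) (1 / 2), lt_min (by linarith) (by norm_num), min_le_left _ _, min_le_right _ _⟩
  have hfar : ∀ q ∈ P.points, ε < ‖q‖ := by
    intro q hq
    by_contra hle
    rw [not_lt] at hle
    have hq1 : q ∈ closedBall (0 : E3) 1 := by
      rw [mem_closedBall, dist_zero_right]; linarith
    have hq2 : q ∈ ball (0 : E3) ε₀ := by
      rw [mem_ball, dist_zero_right]; linarith
    exact hball hq2 ⟨hq1, hq⟩
  have hbad : ∀ N (i : Fin N), ¬ Good P 1 ε (gs N) i := by
    rintro N i ⟨A, -, h2⟩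
    obtain ⟨q, hq, hqi⟩ := h2 i (by simp)
    rw [dist_comm, dist_add_linearIsometry] at hqi
    have := hfar q hq
    linarith
  exact not_badFractionVanishes_of_forall_bad hbad
    (hP 1 ε one_pos hε gs gs_injective excessVanishes_gs)

/-- **A witness has no point in the punctured `δ`-ball about `0`**, `δ > 0` the uniform separation
of Lennard-Jones ground states (tree: `δ = 1/3`): a point `p` with `0 < ‖p‖ < δ` would have to be
matched, around every good particle of a ground state, by a second particle at distance `< δ`.
So the typed matching pins the local scale of `P`: no over-dense junk witness. -/
theorem norm_le_of_mem_points_of_rigidFor :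
    ∃ δ : ℝ, 0 < δ ∧ ∀ P : PeriodicConfiguration 3, RigidFor P → ∀ p ∈ P.points, p ≠ 0 → δ ≤ ‖p‖ := by
  obtain ⟨δ, hδ, hsep⟩ := gs_separated
  refine ⟨δ, hδ, fun P hP p hp hp0 => ?_⟩
  by_contra hlt
  rw [not_le] at hlt
  have hpn : 0 < ‖p‖ := norm_pos_iff.2 hp0
  obtain ⟨ε, hε, hε1, hε2⟩ : ∃ ε : ℝ, 0 < ε ∧ ε ≤ ‖p‖ / 2 ∧ ε ≤ (δ - ‖p‖) / 2 :=
    ⟨min (‖p‖ / 2) ((δ - ‖p‖) / 2), lt_min (by linarith) (by linarith), min_le_left _ _,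
      min_le_right _ _⟩
  have hbad : ∀ N (i : Fin N), ¬ Good P ‖p‖ ε (gs N) i := by
    rintro N i ⟨A, h1, -⟩
    obtain ⟨j, hj⟩ := h1 p hp le_rfl
    by_cases hji : j = i
    · subst hji
      rw [dist_comm, dist_add_linearIsometry] at hj
      linarith
    · have h3 : δ ≤ dist (gs N j) (gs N i) := hsep N j i hji
      have h4 : dist (gs N j) (gs N i) ≤ dist (gs N j) (gs N i + A p) + ‖p‖ :=
        calc dist (gs N j) (gs N i)
            ≤ dist (gs N j) (gs N i + A p) + dist (gs N i + A p) (gs N i) := dist_triangle _ _ _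
          _ = dist (gs N j) (gs N i + A p) + ‖p‖ := by rw [dist_add_linearIsometry]
      linarith
  exact not_badFractionVanishes_of_forall_bad hbad
    (hP ‖p‖ ε hpn hε gs gs_injective excessVanishes_gs)

/-! ## § Refuted strengthenings -/

/-- **The `∀ P` strengthening is false**: the over-dense hcp with spacings `a = h = δ/2` has the
point `barlowPos 1 0 0` at norm `√(a²/3 + h²) = δ/√3 < δ` (`norm_le_of_mem_points_of_rigidFor`).
(Trivial, but it certifies in Lean that the conclusion is a genuine condition on `P`.) -/
theorem not_forall_rigidFor : ¬ ∀ P : PeriodicConfiguration 3, RigidFor P := by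
  intro h
  obtain ⟨δ, hδ, hall⟩ := norm_le_of_mem_points_of_rigidFor
  have ha : (δ / 2 : ℝ) ≠ 0 := by positivity
  have hp : barlowPos (δ / 2) (δ / 2) alternatingHagg 1 0 0 ∈
      (hcpPeriodicConfiguration ha ha).points := by
    rw [hcpPeriodicConfiguration_points]
    exact barlowPos_mem 1 0 0
  have h0 : barlowPos (δ / 2) (δ / 2) alternatingHagg 0 0 0 = 0 := by
    simp [barlowPos]
  have hd := dist_barlowPos_succ_eq (δ / 2) (δ / 2) isHaggSeq_alternating 0 0 0
  rw [zero_add, h0, dist_zero_right] at hd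
  have hlt : ‖barlowPos (δ / 2) (δ / 2) alternatingHagg 1 0 0‖ < δ := by
    rw [hd, Real.sqrt_lt' hδ]
    nlinarith
  have hpos : 0 < ‖barlowPos (δ / 2) (δ / 2) alternatingHagg 1 0 0‖ := by
    rw [hd]; positivity
  have hne : barlowPos (δ / 2) (δ / 2) alternatingHagg 1 0 0 ≠ 0 := norm_pos_iff.1 hpos
  have := hall _ (h _) _ hp hne
  linarith


/-! ## § Counting lemmas (general "few bad indices" bookkeeping) -/

/-- "Few bad": the fraction of indices `i : Fin N` violating `G N` tends to `0`. -/
def FewBad (G : (N : ℕ) → Fin N → Prop) : Prop :=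
  Tendsto (fun N : ℕ => (Nat.card {i : Fin N // ¬ G N i} : ℝ) / N) atTop (𝓝 0)

theorem badFractionVanishes_iff_fewBad {P : PeriodicConfiguration 3} {R ε : ℝ}
    {x : (N : ℕ) → Fin N → E3} :
    BadFractionVanishes P R ε x ↔ FewBad fun N i => Good P R ε (x N) i := Iff.rfl

theorem FewBad.eventually_lt {G : (N : ℕ) → Fin N → Prop} (h : FewBad G) {c : ℝ} (hc : 0 < c) :
    ∀ᶠ N in atTop, (Nat.card {i : Fin N // ¬ G N i} : ℝ) < c * N := by
  have h1 : ∀ᶠ N in atTop, (Nat.card {i : Fin N // ¬ G N i} : ℝ) / N < c :=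
    (tendsto_order.1 h).2 c hc
  filter_upwards [h1, eventually_ge_atTop 1] with N hN hN1
  have hNpos : (0 : ℝ) < N := by exact_mod_cast hN1
  rwa [div_lt_iff₀ hNpos] at hN

/-- Two vanishing bad fractions leave, eventually, an index good for both. -/
theorem FewBad.eventually_exists_good_good {G G' : (N : ℕ) → Fin N → Prop} (h : FewBad G)
    (h' : FewBad G') : ∀ᶠ N in atTop, ∃ i : Fin N, G N i ∧ G' N i := by
  classical
  filter_upwards [h.eventually_lt one_half_pos, h'.eventually_lt one_half_pos] with N h1 h2
  by_contra hno
  have hsub : (Finset.univ : Finset (Fin N)) ⊆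
      (Finset.univ.filter fun i => ¬ G N i) ∪ (Finset.univ.filter fun i => ¬ G' N i) := by
    intro i _
    rw [Finset.mem_union, Finset.mem_filter, Finset.mem_filter]
    by_cases hg : G N i
    · exact Or.inr ⟨Finset.mem_univ _, fun hg' => hno ⟨i, hg, hg'⟩⟩
    · exact Or.inl ⟨Finset.mem_univ _, hg⟩
  have hcard := (Finset.card_le_card hsub).trans (Finset.card_union_le _ _)
  have e1 : Nat.card {i : Fin N // ¬ G N i} = (Finset.univ.filter fun i => ¬ G N i).card := by
    rw [Nat.card_eq_fintype_card, Fintype.card_subtype]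
  have e2 : Nat.card {i : Fin N // ¬ G' N i} = (Finset.univ.filter fun i => ¬ G' N i).card := by
    rw [Nat.card_eq_fintype_card, Fintype.card_subtype]
  rw [Finset.card_univ, Fintype.card_fin, ← e1, ← e2] at hcard
  have : (N : ℝ) ≤ (Nat.card {i : Fin N // ¬ G N i} : ℝ) + Nat.card {i : Fin N // ¬ G' N i} := by
    exact_mod_cast hcard
  linarith

/-- Conjugation `A₁⁻¹ ∘ A₂` of linear isometries of `ℝ³` (finite dimension upgrades `A₁` to an
equivalence). -/
def conj (A₁ A₂ : E3 →ₗᵢ[ℝ] E3) : E3 →ₗᵢ[ℝ] E3 :=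
  (A₁.toLinearIsometryEquiv rfl).symm.toLinearIsometry.comp A₂

theorem dist_conj (A₁ A₂ : E3 →ₗᵢ[ℝ] E3) (p₀ q q' : E3) :
    dist q' (p₀ + conj A₁ A₂ q) = dist (A₁ q') (A₁ p₀ + A₂ q) := by
  rw [← (A₁.toLinearIsometryEquiv rfl).dist_map q' (p₀ + conj A₁ A₂ q), map_add]
  simp [conj]

/-! ## § Necessary conditions on a witness (continued): uniqueness and vertex-transitivity -/

/-- **Two witnesses are congruent** up to a linear isometry, at every radius and tolerance:
ground states are matched to both, so around a doubly-good particle `A₁ P ≈ A₂ P'`.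
(`S` pins the witness uniquely up to `O(3)`: no second, non-congruent `P` can ever be "also
true".) -/
theorem rigidFor_unique_up_to_isometry {P P' : PeriodicConfiguration 3} (hP : RigidFor P)
    (hP' : RigidFor P') {R ε : ℝ} (hR : 0 < R) (hε : 0 < ε) :
    ∃ B : E3 →ₗᵢ[ℝ] E3,
      (∀ p ∈ P.points, ‖p‖ ≤ R → ∃ p' ∈ P'.points, dist p' (B p) ≤ ε) ∧
      (∀ p' ∈ P'.points, ‖p'‖ ≤ R → ∃ p ∈ P.points, dist p' (B p) ≤ ε) := by
  obtain ⟨ε₁, hε₁, hε₁ε, hε₁1⟩ : ∃ ε₁ : ℝ, 0 < ε₁ ∧ 2 * ε₁ ≤ ε ∧ ε₁ ≤ 1 :=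
    ⟨min (ε / 2) 1, lt_min (by linarith) one_pos, by linarith [min_le_left (ε / 2) (1 : ℝ)],
      min_le_right _ _⟩
  have h1 := hP (R + 1) ε₁ (by linarith) hε₁ gs gs_injective excessVanishes_gs
  have h2 := hP' (R + 1) ε₁ (by linarith) hε₁ gs gs_injective excessVanishes_gs
  obtain ⟨N, i, ⟨A₁, ha1, hb1⟩, ⟨A₂, ha2, hb2⟩⟩ :=
    (FewBad.eventually_exists_good_good (G := fun N i => Good P (R + 1) ε₁ (gs N) i)
      (G' := fun N i => Good P' (R + 1) ε₁ (gs N) i) h1 h2).exists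
  have hconj : ∀ p p' : E3, dist p' (conj A₂ A₁ p) = dist (A₂ p') (A₁ p) := fun p p' => by
    have := dist_conj A₂ A₁ 0 p p'
    rwa [zero_add, map_zero, zero_add] at this
  refine ⟨conj A₂ A₁, fun p hp hpR => ?_, fun p' hp' hp'R => ?_⟩
  · obtain ⟨j, hj⟩ := ha1 p hp (by linarith)
    have hji : dist (gs N j) (gs N i) ≤ R + 1 :=
      calc dist (gs N j) (gs N i)
          ≤ dist (gs N j) (gs N i + A₁ p) + dist (gs N i + A₁ p) (gs N i) := dist_triangle _ _ _
        _ ≤ ε₁ + ‖p‖ := by rw [dist_add_linearIsometry]; linarith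
        _ ≤ R + 1 := by linarith
    obtain ⟨p', hp', hjp'⟩ := hb2 j hji
    refine ⟨p', hp', ?_⟩
    rw [hconj]
    calc dist (A₂ p') (A₁ p) = dist (gs N i + A₂ p') (gs N i + A₁ p) := (dist_add_left _ _ _).symm
      _ ≤ dist (gs N i + A₂ p') (gs N j) + dist (gs N j) (gs N i + A₁ p) := dist_triangle _ _ _
      _ ≤ ε₁ + ε₁ := by rw [dist_comm] at hjp'; linarith
      _ ≤ ε := by linarith
  · obtain ⟨j, hj⟩ := ha2 p' hp' (by linarith)
    have hji : dist (gs N j) (gs N i) ≤ R + 1 :=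
      calc dist (gs N j) (gs N i)
          ≤ dist (gs N j) (gs N i + A₂ p') + dist (gs N i + A₂ p') (gs N i) := dist_triangle _ _ _
        _ ≤ ε₁ + ‖p'‖ := by rw [dist_add_linearIsometry]; linarith
        _ ≤ R + 1 := by linarith
    obtain ⟨p, hp, hjp⟩ := hb1 j hji
    refine ⟨p, hp, ?_⟩
    rw [hconj]
    calc dist (A₂ p') (A₁ p) = dist (gs N i + A₂ p') (gs N i + A₁ p) := (dist_add_left _ _ _).symm
      _ ≤ dist (gs N i + A₂ p') (gs N j) + dist (gs N j) (gs N i + A₁ p) := dist_triangle _ _ _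
      _ ≤ ε₁ + ε₁ := by rw [dist_comm] at hj; linarith
      _ ≤ ε := by linarith

/-- **A witness is vertex-transitive up to linear isometries, at every tolerance**: for every
point `p₀ ∈ P.points` and every `(R, ε)` there is a linear isometry `B` with
`(P.points − p₀) ∩ B_R` two-way `ε`-matched to `B (P.points)`.  Proof: in a large ground state
most particles are good at radius `‖p₀‖ + R + 1`; a packing count (fibres of the map "good
particle ↦ the particle sitting at its image of `p₀`" have size `≤ (2(‖p₀‖+ε₁)/δ + 1)³` by the
uniform separation `δ`) produces a good particle whose `p₀`-neighbour is also good; comparing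
their two matchings gives `B = A₁⁻¹ A₂`.

CONSEQUENCE (the typed statement's extra content): hcp and fcc (one orbit of sites under the
space group) can be witnesses; dhcp/4H, 6H, 9R, and every longer close-packed polytype have both
h- and c-type sites whose 12-shells (anticuboctahedron vs cuboctahedron) are not congruent, so at
`R` just above the neighbour distance and small `ε` they violate this conclusion — if the
Lennard-Jones optimum were such a polytype, `SlackRigidity` would be false for EVERY `P`
(for `P = hcp` because ground states would then not be hcp-like), although "crystallisation
onto one periodic `P`" would still hold. -/
theorem rigidFor_vertexTransitive {P : PeriodicConfiguration 3} (hP : RigidFor P) {p₀ : E3}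
    (hp₀ : p₀ ∈ P.points) {R ε : ℝ} (hR : 0 < R) (hε : 0 < ε) :
    ∃ B : E3 →ₗᵢ[ℝ] E3,
      (∀ q ∈ P.points, ‖q‖ ≤ R → ∃ q' ∈ P.points, dist q' (p₀ + B q) ≤ ε) ∧
      (∀ q' ∈ P.points, dist q' p₀ ≤ R → ∃ q ∈ P.points, dist q' (p₀ + B q) ≤ ε) := by
  classical
  obtain ⟨δ, hδ, hsep⟩ := gs_separated
  obtain ⟨ε₁, hε₁, hε₁ε, hε₁1⟩ : ∃ ε₁ : ℝ, 0 < ε₁ ∧ 3 * ε₁ ≤ ε ∧ 2 * ε₁ ≤ 1 :=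
    ⟨min (ε / 3) (1 / 2), lt_min (by linarith) (by norm_num),
      by linarith [min_le_left (ε / 3) (1 / 2 : ℝ)], by linarith [min_le_right (ε / 3) (1 / 2 : ℝ)]⟩
  set R₁ : ℝ := ‖p₀‖ + R + 1 with hR₁
  have hR₁pos : 0 < R₁ := by positivity
  have hfew : FewBad fun N i => Good P R₁ ε₁ (gs N) i :=
    hP R₁ ε₁ hR₁pos hε₁ gs gs_injective excessVanishes_gs
  set C : ℝ := (2 * (‖p₀‖ + ε₁) / δ + 1) ^ Module.finrank ℝ E3 with hC
  have hCpos : 0 < C := by positivity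
  set c : ℝ := 1 / (2 * (C + 1)) with hc
  have hcpos : 0 < c := by positivity
  obtain ⟨N, hlt, hN1⟩ := ((hfew.eventually_lt hcpos).and (eventually_ge_atTop 1)).exists
  haveI : Nonempty (Fin N) := ⟨⟨0, hN1⟩⟩
  haveI : Nonempty (E3 →ₗᵢ[ℝ] E3) := ⟨LinearIsometry.id⟩
  set x := gs N with hx
  have hxinj : Function.Injective x := gs_injective N
  have hxsep : ∀ a a' : Fin N, a ≠ a' → δ ≤ dist (x a) (x a') := hsep N
  -- choices attached to good particles
  have hchoice : ∀ i : Fin N, Good P R₁ ε₁ x i → ∃ A : E3 →ₗᵢ[ℝ] E3, ∃ j : Fin N,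
      (∀ p ∈ P.points, ‖p‖ ≤ R₁ → ∃ k : Fin N, dist (x k) (x i + A p) ≤ ε₁) ∧
      (∀ k : Fin N, dist (x k) (x i) ≤ R₁ → ∃ p ∈ P.points, dist (x k) (x i + A p) ≤ ε₁) ∧
      dist (x j) (x i + A p₀) ≤ ε₁ := by
    rintro i ⟨A, ha, hb⟩
    obtain ⟨j, hj⟩ := ha p₀ hp₀ (by rw [hR₁]; linarith)
    exact ⟨A, j, ha, hb, hj⟩
  choose! A j hA hB hj using hchoice
  set G := Finset.univ.filter fun i => Good P R₁ ε₁ x i with hG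
  set Bd := Finset.univ.filter fun i => ¬ Good P R₁ ε₁ x i with hBd
  have hBd_card : (Bd.card : ℝ) < c * N := by
    have e : Nat.card {i : Fin N // ¬ Good P R₁ ε₁ x i} = Bd.card := by
      rw [Nat.card_eq_fintype_card, Fintype.card_subtype]
    have := hlt
    rw [e] at this
    exact this
  have hGB : (G.card : ℝ) + Bd.card = N := by
    have := Finset.card_filter_add_card_filter_not
      (s := (Finset.univ : Finset (Fin N))) (fun i => Good P R₁ ε₁ x i)
    rw [Finset.card_univ, Fintype.card_fin] at this
    exact_mod_cast this
  -- some good particle has a good `p₀`-neighbour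
  have hexists : ∃ i ∈ G, j i ∈ G := by
    by_contra hno
    have hmaps : ∀ i ∈ G, j i ∈ Bd := by
      intro i hi
      rw [hBd, Finset.mem_filter]
      refine ⟨Finset.mem_univ _, fun hgood => hno ⟨i, hi, ?_⟩⟩
      rw [hG, Finset.mem_filter]
      exact ⟨Finset.mem_univ _, hgood⟩
    have hfib : ∀ b ∈ Bd, ((G.filter fun a => j a = b).card : ℝ) ≤ C := by
      intro b _
      have hcard : (((G.filter fun a => j a = b).image x).card : ℝ) =
          (G.filter fun a => j a = b).card := by
        rw [Finset.card_image_of_injective _ hxinj]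
      rw [← hcard, hC]
      refine card_le_of_separated_of_dist_le ((G.filter fun a => j a = b).image x) (x b) hδ
        (by positivity) ?_ ?_
      · intro cpt hcpt
        obtain ⟨a, ha, rfl⟩ := Finset.mem_image.1 hcpt
        have haG : a ∈ G := (Finset.mem_filter.1 ha).1
        have hja : j a = b := (Finset.mem_filter.1 ha).2
        have hgood : Good P R₁ ε₁ x a := (Finset.mem_filter.1 haG).2
        have hd := hj a hgood
        rw [hja] at hd
        calc dist (x a) (x b) = dist (x b) (x a) := dist_comm _ _
          _ ≤ dist (x b) (x a + A a p₀) + dist (x a + A a p₀) (x a) := dist_triangle _ _ _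
          _ ≤ ε₁ + ‖p₀‖ := by rw [dist_add_linearIsometry]; linarith
          _ = ‖p₀‖ + ε₁ := by ring
      · intro cpt hcpt dpt hdpt hne
        obtain ⟨a, -, rfl⟩ := Finset.mem_image.1 hcpt
        obtain ⟨a', -, rfl⟩ := Finset.mem_image.1 hdpt
        exact hxsep a a' (fun h => hne (by rw [h]))
    have hsum : (G.card : ℝ) ≤ Bd.card * C := by
      have h1 : G.card = ∑ b ∈ Bd, (G.filter fun a => j a = b).card :=
        Finset.card_eq_sum_card_fiberwise hmaps
      have h2 : (G.card : ℝ) = ∑ b ∈ Bd, ((G.filter fun a => j a = b).card : ℝ) := by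
        rw [h1]; exact Nat.cast_sum _ _
      rw [h2]
      calc ∑ b ∈ Bd, ((G.filter fun a => j a = b).card : ℝ) ≤ ∑ b ∈ Bd, C :=
            Finset.sum_le_sum hfib
        _ = Bd.card * C := by rw [Finset.sum_const, nsmul_eq_mul]
    have hN : (1 : ℝ) ≤ N := by exact_mod_cast hN1
    have h3 : (N : ℝ) ≤ (C + 1) * Bd.card := by linarith
    have h4 : (C + 1) * (Bd.card : ℝ) < (C + 1) * (c * N) :=
      mul_lt_mul_of_pos_left hBd_card (by positivity)
    have hC1 : (C + 1) ≠ 0 := by positivity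
    have hcC : (C + 1) * (c * N) = N / 2 := by
      rw [hc]; field_simp
    linarith
  obtain ⟨i, hiG, hjG⟩ := hexists
  have hgi : Good P R₁ ε₁ x i := (Finset.mem_filter.1 hiG).2
  have hgj : Good P R₁ ε₁ x (j i) := (Finset.mem_filter.1 hjG).2
  have hy : dist (x (j i)) (x i + A i p₀) ≤ ε₁ := hj i hgi
  have hyi : dist (x (j i)) (x i) ≤ ε₁ + ‖p₀‖ :=
    calc dist (x (j i)) (x i) ≤ dist (x (j i)) (x i + A i p₀) + dist (x i + A i p₀) (x i) :=
          dist_triangle _ _ _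
      _ ≤ ε₁ + ‖p₀‖ := by rw [dist_add_linearIsometry]; linarith
  refine ⟨conj (A i) (A (j i)), fun q hq hqR => ?_, fun q' hq' hq'R => ?_⟩
  · -- clause (a): points of `P` near `0`, transported to `p₀`
    obtain ⟨k, hk⟩ := hA (j i) hgj q hq (by rw [hR₁]; linarith [norm_nonneg p₀])
    have hki : dist (x k) (x i) ≤ R₁ :=
      calc dist (x k) (x i)
          ≤ dist (x k) (x (j i) + A (j i) q) + dist (x (j i) + A (j i) q) (x (j i)) +
            dist (x (j i)) (x i) := dist_triangle4 _ _ _ _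
        _ ≤ ε₁ + ‖q‖ + (ε₁ + ‖p₀‖) := by rw [dist_add_linearIsometry]; linarith
        _ ≤ R₁ := by rw [hR₁]; linarith
    obtain ⟨q'', hq'', hkq''⟩ := hB i hgi k hki
    refine ⟨q'', hq'', ?_⟩
    rw [dist_conj]
    calc dist (A i q'') (A i p₀ + A (j i) q)
        = dist (x i + A i q'') (x i + A i p₀ + A (j i) q) := by rw [add_assoc, dist_add_left]
      _ ≤ dist (x i + A i q'') (x k) + dist (x k) (x (j i) + A (j i) q) +
            dist (x (j i) + A (j i) q) (x i + A i p₀ + A (j i) q) := dist_triangle4 _ _ _ _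
      _ ≤ ε₁ + ε₁ + ε₁ := by
          rw [dist_add_right, dist_comm (x i + A i q'')]
          linarith
      _ ≤ ε := by linarith
  · -- clause (b): points of `P` near `p₀`, pulled back to `0`
    have hq'norm : ‖q'‖ ≤ R₁ :=
      calc ‖q'‖ = ‖(q' - p₀) + p₀‖ := by rw [sub_add_cancel]
        _ ≤ ‖q' - p₀‖ + ‖p₀‖ := norm_add_le _ _
        _ = dist q' p₀ + ‖p₀‖ := by rw [dist_eq_norm]
        _ ≤ R₁ := by rw [hR₁]; linarith
    obtain ⟨k, hk⟩ := hA i hgi q' hq' hq'norm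
    have hkj : dist (x k) (x (j i)) ≤ R₁ :=
      calc dist (x k) (x (j i))
          ≤ dist (x k) (x i + A i q') + dist (x i + A i q') (x i + A i p₀) +
            dist (x i + A i p₀) (x (j i)) := dist_triangle4 _ _ _ _
        _ ≤ ε₁ + R + ε₁ := by
            rw [dist_add_left, LinearIsometry.dist_map, dist_comm (x i + A i p₀)]
            linarith
        _ ≤ R₁ := by rw [hR₁]; linarith [norm_nonneg p₀]
    obtain ⟨q, hq, hkq⟩ := hB (j i) hgj k hkj
    refine ⟨q, hq, ?_⟩
    rw [dist_conj]
    calc dist (A i q') (A i p₀ + A (j i) q)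
        = dist (x i + A i q') (x i + A i p₀ + A (j i) q) := by rw [add_assoc, dist_add_left]
      _ ≤ dist (x i + A i q') (x k) + dist (x k) (x (j i) + A (j i) q) +
            dist (x (j i) + A (j i) q) (x i + A i p₀ + A (j i) q) := dist_triangle4 _ _ _ _
      _ ≤ ε₁ + ε₁ + ε₁ := by
          rw [dist_add_right, dist_comm (x i + A i q')]
          linarith
      _ ≤ ε := by linarith

/-- **A witness is uniformly discrete with the ground-state separation `δ`** (tree: `1/3`):
combine `rigidFor_vertexTransitive` (look at `P` from the point `q`) with
`norm_le_of_mem_points_of_rigidFor` (punctured `δ`-ball about `0` is empty). So `S` pins the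
witness to the scale of real ground states: no decorated / over-dense / accidental-coincidence
`P` can be slipped in. -/
theorem rigidFor_uniformlyDiscrete : ∃ δ : ℝ, 0 < δ ∧ ∀ P : PeriodicConfiguration 3, RigidFor P →
    ∀ p ∈ P.points, ∀ q ∈ P.points, p ≠ q → δ ≤ dist p q := by
  obtain ⟨δ, hδ, hall⟩ := norm_le_of_mem_points_of_rigidFor
  refine ⟨δ, hδ, fun P hP p hp q hq hpq => ?_⟩
  by_contra hlt
  rw [not_le] at hlt
  have hd : 0 < dist p q := dist_pos.2 hpq
  obtain ⟨ε, hε, hε1, hε2⟩ : ∃ ε : ℝ, 0 < ε ∧ ε ≤ dist p q / 3 ∧ ε ≤ (δ - dist p q) / 3 :=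
    ⟨min (dist p q / 3) ((δ - dist p q) / 3), lt_min (by linarith) (by linarith), min_le_left _ _,
      min_le_right _ _⟩
  obtain ⟨B, -, hb⟩ := rigidFor_vertexTransitive hP hq hd hε
  obtain ⟨q₀, hq₀, hpq₀⟩ := hb p hp le_rfl
  have hnorm : dist (q + B q₀) q = ‖q₀‖ := dist_add_linearIsometry B q q₀
  by_cases h0 : q₀ = 0
  · subst h0
    rw [map_zero, add_zero] at hpq₀
    linarith
  · have h1 := hall P hP q₀ hq₀ h0
    have h2 : ‖q₀‖ ≤ dist p q + ε := by
      rw [← hnorm]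
      calc dist (q + B q₀) q ≤ dist (q + B q₀) p + dist p q := dist_triangle _ _ _
        _ ≤ ε + dist p q := by rw [dist_comm] at hpq₀; linarith
        _ = dist p q + ε := by ring
    linarith

/-! ## § Load-bearing hypotheses (continued): the isometry `A` -/

/-- Translation-only matching: the crux's predicate with the isometry frozen to `A = 1`. -/
def GoodT (P : PeriodicConfiguration 3) (R ε : ℝ) {N : ℕ} (x : Fin N → E3) (i : Fin N) : Prop :=
  (∀ p ∈ P.points, ‖p‖ ≤ R → ∃ j : Fin N, dist (x j) (x i + p) ≤ ε) ∧
    (∀ j : Fin N, dist (x j) (x i) ≤ R → ∃ p ∈ P.points, dist (x j) (x i + p) ≤ ε)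

/-- The crux's inner statement for a witness `P` WITHOUT ROTATIONS (environments must match `P`
in a fixed orientation). -/
def RigidForWithoutRotations (P : PeriodicConfiguration 3) : Prop :=
  ∀ R ε : ℝ, 0 < R → 0 < ε → ∀ x : (N : ℕ) → Fin N → E3,
    (∀ N, Function.Injective (x N)) → ExcessVanishes x → FewBad fun N i => GoodT P R ε (x N) i

/-- Every periodic configuration has a non-zero point. -/
theorem exists_ne_zero_mem_points' (P : PeriodicConfiguration 3) : ∃ p ∈ P.points, p ≠ 0 := by
  by_cases h0 : (0 : E3) ∈ P.points
  · exact exists_ne_zero_mem_points P h0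
  · obtain ⟨y, hy⟩ := P.points_nonempty
    exact ⟨y, hy, fun h => h0 (h ▸ hy)⟩

/-- **`_false_without_` (rotations).** With `A` frozen to the identity the statement fails for
EVERY `P`: reflecting a ground-state sequence is again a ground-state sequence, and a particle
good for both forces every point of the sphere `‖q‖ = ‖p‖` (`p ∈ P.points ∖ 0`) into the closed,
locally finite set `P.points` — but that sphere is infinite. Any proof must let `A` depend on the
particle (rotational covariance of near-minimisers is real: grains, twins). -/
theorem not_rigidForWithoutRotations (P : PeriodicConfiguration 3) :
    ¬ RigidForWithoutRotations P := by
  intro hP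
  obtain ⟨p, hp, hp0⟩ := exists_ne_zero_mem_points' P
  have hpn : 0 < ‖p‖ := norm_pos_iff.2 hp0
  have hsphere : sphere (0 : E3) ‖p‖ ⊆ P.points := by
    intro q hq
    rw [mem_sphere_zero_iff_norm] at hq
    have happrox : ∀ ε : ℝ, 0 < ε → ε ≤ 1 → ∃ p' ∈ P.points, dist p' q ≤ 2 * ε := by
      intro ε hε hε1
      obtain ⟨B, hB⟩ : ∃ B : E3 ≃ₗᵢ[ℝ] E3, B q = p :=
        ⟨Submodule.reflection (ℝ ∙ (q - p))ᗮ, Submodule.reflection_sub hq⟩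
      set x' : (N : ℕ) → Fin N → E3 := fun N i => B (gs N i) with hx'
      have hgs' : ∀ N, IsGroundState lennardJones (x' N) := fun N =>
        (isGroundState_comp_isometry_iff lennardJones B.isometry).2 (gs_isGroundState N)
      have h1 := hP (‖p‖ + 1) ε (by linarith) hε gs gs_injective excessVanishes_gs
      have h2 := hP (‖p‖ + 1) ε (by linarith) hε x' (fun N => (hgs' N).1)
        (excessVanishes_of_isGroundState hgs')
      obtain ⟨N, i, ⟨-, hb1⟩, ⟨ha2, -⟩⟩ := (FewBad.eventually_exists_good_good h1 h2).exists
      obtain ⟨j, hj⟩ := ha2 p hp (by linarith)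
      change dist (B (gs N j)) (B (gs N i) + p) ≤ ε at hj
      have hj' : dist (gs N j) (gs N i + q) ≤ ε := by
        rw [← hB, ← map_add, B.dist_map] at hj
        exact hj
      have hji : dist (gs N j) (gs N i) ≤ ‖p‖ + 1 :=
        calc dist (gs N j) (gs N i)
            ≤ dist (gs N j) (gs N i + q) + dist (gs N i + q) (gs N i) := dist_triangle _ _ _
          _ ≤ ε + ‖q‖ := by rw [dist_eq_norm (gs N i + q), add_sub_cancel_left]; linarith
          _ ≤ ‖p‖ + 1 := by rw [hq]; linarith
      obtain ⟨p', hp', hjp'⟩ := hb1 j hji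
      refine ⟨p', hp', ?_⟩
      calc dist p' q = dist (gs N i + p') (gs N i + q) := (dist_add_left _ _ _).symm
        _ ≤ dist (gs N i + p') (gs N j) + dist (gs N j) (gs N i + q) := dist_triangle _ _ _
        _ ≤ ε + ε := by rw [dist_comm] at hjp'; linarith
        _ = 2 * ε := by ring
    have hfin : (closedBall (0 : E3) (‖p‖ + 2) ∩ P.points).Finite :=
      P.finite_inter_points isBounded_closedBall
    have hmem : q ∈ closure (closedBall (0 : E3) (‖p‖ + 2) ∩ P.points) := by
      rw [Metric.mem_closure_iff]
      intro η hη
      obtain ⟨ε, hε, hε1, hεη⟩ : ∃ ε : ℝ, 0 < ε ∧ ε ≤ 1 ∧ 2 * ε < η :=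
        ⟨min (η / 4) 1, lt_min (by linarith) one_pos, min_le_right _ _,
          by linarith [min_le_left (η / 4) (1 : ℝ)]⟩
      obtain ⟨p', hp', hd⟩ := happrox ε hε hε1
      refine ⟨p', ⟨?_, hp'⟩, ?_⟩
      · rw [mem_closedBall, dist_zero_right]
        calc ‖p'‖ = ‖(p' - q) + q‖ := by rw [sub_add_cancel]
          _ ≤ ‖p' - q‖ + ‖q‖ := norm_add_le _ _
          _ = dist p' q + ‖p‖ := by rw [dist_eq_norm, hq]
          _ ≤ ‖p‖ + 2 := by linarith
      · rw [dist_comm]; linarith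
    rw [hfin.isClosed.closure_eq] at hmem
    exact hmem.2
  have hinf : (sphere (0 : E3) ‖p‖).Infinite := by
    refine (isPreconnected_sphere ?_ (0 : E3) ‖p‖).infinite_of_nontrivial ?_
    · rw [← Module.finrank_eq_rank, finrank_euclideanSpace_fin]
      norm_num
    · refine ⟨p, by simp, -p, by simp, fun h => ?_⟩
      have h2 : (2 : ℝ) • p = 0 := by
        rw [two_smul]
        nth_rewrite 2 [h]
        exact add_neg_cancel p
      rw [smul_eq_zero] at h2
      norm_num at h2
      exact hp0 h2
  have hfin : (closedBall (0 : E3) ‖p‖ ∩ P.points).Finite := P.finite_inter_points isBounded_closedBall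
  exact hinf (hfin.subset fun q hq => ⟨sphere_subset_closedBall hq, hsphere hq⟩)

/-- Hence no periodic configuration at all satisfies the rotation-free version. -/
theorem not_exists_rigidForWithoutRotations :
    ¬ ∃ P : PeriodicConfiguration 3, RigidForWithoutRotations P :=
  fun ⟨P, hP⟩ => not_rigidForWithoutRotations P hP

/-! ## § Sanity: the intended witness passes the transitivity test (hcp is homogeneous)

Positive-side information for the provers, now LANDED as
`Literature/MathematicalPhysics/StatisticalMechanics/HcpHomogeneous.lean` (p73417, commit b1b50a35c3b0):
`hcpStacking_homogeneous` — for every point `p₀` of `hcpStacking a h` the identity (even layers) or the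
half-turn about `e₃` (odd layers) `B` satisfies `q ∈ HCP ↔ p₀ + B q ∈ HCP`.  Hence hcp meets the
conclusion of `rigidFor_vertexTransitive` exactly (`ε = 0` allowed), at every radius: the typed crux
does NOT exclude its intended witness on transitivity grounds (fcc: trivial; dhcp/6H/9R: fail). -/

section HcpSanity

variable {a h : ℝ}

/-- **hcp passes the vertex-transitivity test of `rigidFor_vertexTransitive`, with tolerance `0`.** -/
theorem hcp_passes_vertexTransitivity (ha : a ≠ 0) (hh : h ≠ 0) {p₀ : E3}
    (hp₀ : p₀ ∈ (hcpPeriodicConfiguration ha hh).points) (R ε : ℝ) (hε : 0 ≤ ε) :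
    ∃ B : E3 →ₗᵢ[ℝ] E3,
      (∀ q ∈ (hcpPeriodicConfiguration ha hh).points, ‖q‖ ≤ R →
        ∃ q' ∈ (hcpPeriodicConfiguration ha hh).points, dist q' (p₀ + B q) ≤ ε) ∧
      (∀ q' ∈ (hcpPeriodicConfiguration ha hh).points, dist q' p₀ ≤ R →
        ∃ q ∈ (hcpPeriodicConfiguration ha hh).points, dist q' (p₀ + B q) ≤ ε) := by
  obtain ⟨B, hB⟩ := hcpPeriodicConfiguration_homogeneous a h ha hh hp₀
  refine ⟨B.toLinearIsometry, fun q hq _ => ⟨p₀ + B q, (hB q).1 hq, by simpa using hε⟩,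
    fun q' hq' _ => ⟨B.symm (q' - p₀), ?_, ?_⟩⟩
  · rw [hB, LinearIsometryEquiv.apply_symm_apply, add_sub_cancel]
    exact hq'
  · change dist q' (p₀ + B (B.symm (q' - p₀))) ≤ ε
    rw [LinearIsometryEquiv.apply_symm_apply, add_sub_cancel, dist_self]
    exact hε

end HcpSanity

/-! ## § Numerics (kit jobs; informative only, nothing here is used by the Lean theorems) -/

/-- NUMERICS LOG (tree units `V = r⁻¹²/12 − r⁻⁶/6`; floating point, NOT interval-certified; informative only).
Route file: `e(hcp) = −0.71759 < e(fcc) = −0.71752` (Stillinger 2001 sums); prior refuter job `j003849`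
(result not readable from this hub).

**This seat, kit job `j008617`** (script `job1/main.py`, 1 core, 289 s, exit 0, bundle sha256
`4e1f691f…38e3`; duplicate `j009315` cancelled). Method: layer decomposition of close-packed stackings
`e(w; a, h) = S₀(a)/2 + Σ_{k≥1}[c_k(w) Φ_same(kh) + (1 − c_k(w)) Φ_diff(kh)]` (2-D triangular sums to
radius 60 + continuum tails, 120 layers + tail), Nelder–Mead relaxation of `(a, h)` per stacking word,
registry coefficients `D_k = Φ_diff(kh) − Φ_same(kh)` at the relaxed hcp geometry, the Hägg-type bound
(valid at FIXED `(a, h)` for every stacking sequence, periodic or not):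
`e(w) − e(hcp) ≥ ν_c(w)·M`, `M := D₂ − Σ_{k≥3}(k−1)|D_k|`, `ν_c` = density of c-type layers.
Results:
* relaxed hcp: `a* = 0.971274`, `c/a = 1.632763` (ideal `1.632993`; ideal-`c/a` hcp lies `6.1·10⁻⁸`
  higher), `e(hcp) = −0.7175892025`; 3-D direct sum (`R_c = 45` + tail) `−0.7175892070` (agree to 4·10⁻⁹).
* `e(fcc) = −0.7175166766` (`+7.253·10⁻⁵`), dhcp `+3.632·10⁻⁵`, 6H `+4.839·10⁻⁵`, 9R `+2.422·10⁻⁵`,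
  8H `+3.631·10⁻⁵`, 10H `+2.905·10⁻⁵`, nine random words of periods 5–40: all `= ν_c·7.25·10⁻⁵ ± 2·10⁻⁷`.
* `D₁ = −0.783` (adjacent layers, irrelevant: always "diff"), `D₂ = +7.267·10⁻⁵`, `D₃ = +8.5·10⁻⁸`,
  `|D_k| ≤ 2.1·10⁻¹⁰` for `k ≥ 4` (truncation floor `≈ 10⁻¹⁰`); margin **`M = +7.239·10⁻⁵ > 0`**.
* relaxation gains beyond the fixed-geometry bound: `(a, h)` per word `≤ 6.2·10⁻⁸` (fcc), individual
  layer-spacing classes (6H, 9R) `≈ 2·10⁻⁹` — two to three orders below `ν_c·M` for every word tested, and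
  every tested word still satisfies `e − e(hcp) ≥ ν_c·M` AFTER relaxation.
* hcp 9×9 Hessian (6 symmetric strains + 3 internal sublattice displacements, FD step `4·10⁻³`,
  `R_c = 16`): eigenvalues `2.24, 2.72, 2.73, 2.94, 5.71, 8.65, 9.21, 17.3, 20.9` — all `> 0`: strict local
  minimum modulo rigid motions, no soft homogeneous or optical (Γ-point) mode. (A residual gradient
  `≈ 4·10⁻⁴` in the strains / `10⁻⁴` in `u_y` is the sharp-cutoff artefact at `R_c = 16`; irrelevant at
  the `O(1)` scale of the eigenvalues.)
READING for the kill route (3) of the route file ("exact polytype tie / aperiodic optimal stacking"):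
numerically CLOSED — hcp beats every other close-packed stacking sequence by `≈ 7.2·10⁻⁵` per c-layer
(relative `1.0·10⁻⁴` of `|e|`), so a fault plane costs `≍ 7·10⁻⁵ × (#particles in the layer)`, an
`o(N)`-excess sequence carries `o(N^{1/3})` c-layers and only `o(N)` spoiled environments; no tie, no
aperiodic optimum, no degenerate soft mode at Γ. What stays OPEN (and unformalisable today): non-Barlow
competitors, phonon stability away from Γ, and of course the crystallisation / coercivity content. -/
theorem numerics_note : True := trivial

end Summit.AtomisticToContinuum.Crystallization.Cruxes.SlackRigidity.Disproof

end
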